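import Literature.Analysis.ODE.HeunFlip
import Literature.Geometry.Lorentzian.KerrDeSitterHeunForm
import Summits.Ventures.KdS.RouteW
import HarnessLib

/-!
# Venture KdS — the spin flip `s ↦ −s`: parameter bookkeeping of the flipped Heun frames

HONEST FRAMING (venture `Summits/Ventures/KdS`, cell `pub-kds`; STRUCTURE.md C3): pure algebra
feeding `RouteWSpinFlip.lean` (the Teukolsky–Starobinsky transfer as Umetsu's `2s`-th derivative
in the exponent-flipped Hatsuda frame). For Hatsuda's radial Heun data of spin `s`
(`heunGamma/Delta/Eps`, `heunSigmaPlus = 2s+1`, `heunSigmaMinus`, `heunV`; tree file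
`KerrDeSitterHeunForm`) and `N = 2s`: the flipped frame has Heun `α = 2 − σ₊ = 1 − N`
(`two_sub_sigmaPlus`); Umetsu's shifted parameters of the flipped spin-`s` data are the flipped
spin-`−s` data (`image_gamma/delta/eps/sigmaPlus/sigmaMinus`), INCLUDING the accessory parameter
at the shifted separation constant `λ' = λ − 2s(1−α)` of `RouteW.lamFlip` (`accessory_identity` =
the general-Heun identity `shiftedQ_flipQ_sub` + the Kerr–de Sitter identity `heunV_flip_diff`,
which uses Vieta's `1 − Λa²/3 = (Λ/3)(S² − e₂)`; exact CAS cross-check: pub-kds kit j175340,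
j175397, j175983). Nothing about solutions is claimed here.
-/

noncomputable section

open Set Complex

namespace Summit.Ventures.KdS

namespace SpinFlipTS

open Literature.Analysis.ODE Literature.Analysis.ODE.GeneralHeun
open Literature.Geometry.Lorentzian Literature.Geometry.Lorentzian.KerrDeSitter

/-! ### Parameter bookkeeping of the flipped frames -/

/-- In the flipped spin-`s` frame Heun's `α` is `2 − σ₊ = 1 − 2s`. -/
theorem two_sub_sigmaPlus (s : ℝ) {N : ℕ} (hsN : 2 * s = N) :
    2 - heunSigmaPlus s = 1 - (N : ℂ) := by
  have h : (2 * s : ℝ) = (N : ℝ) := hsN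
  have h' : (2 : ℂ) * (s : ℂ) = (N : ℂ) := by exact_mod_cast h
  unfold heunSigmaPlus
  linear_combination -h'

/-- Image exponent at `z = 0`: `(2 − γ_s) + 2s = 2 − γ_{−s}`. -/
theorem image_gamma (M a Λ s : ℝ) (ω : ℂ) (m : ℝ) {N : ℕ} (hsN : 2 * s = N) :
    2 - heunGamma M a Λ s ω m + N = 2 - heunGamma M a Λ (-s) ω m := by
  have h' : (2 : ℂ) * (s : ℂ) = (N : ℂ) := by exact_mod_cast hsN
  unfold heunGamma; push_cast; linear_combination -h'

/-- Image exponent at `z = 1`: `(2 − δ_s) + 2s = 2 − δ_{−s}`. -/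
theorem image_delta (M a Λ s : ℝ) (ω : ℂ) (m : ℝ) {N : ℕ} (hsN : 2 * s = N) :
    2 - heunDelta M a Λ s ω m + N = 2 - heunDelta M a Λ (-s) ω m := by
  have h' : (2 : ℂ) * (s : ℂ) = (N : ℂ) := by exact_mod_cast hsN
  unfold heunDelta; push_cast; linear_combination -h'

/-- Image exponent at `z = z_r`: `(2 − ε_s) + 2s = 2 − ε_{−s}`. -/
theorem image_eps (M a Λ s : ℝ) (ω : ℂ) (m : ℝ) {N : ℕ} (hsN : 2 * s = N) :
    2 - heunEps M a Λ s ω m + N = 2 - heunEps M a Λ (-s) ω m := by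
  have h' : (2 : ℂ) * (s : ℂ) = (N : ℂ) := by exact_mod_cast hsN
  unfold heunEps; push_cast; linear_combination -h'

/-- Image exponent at `∞` (Umetsu's `α̃ = N + 1`): `2s + 1 = 2 − σ₊(−s)`. -/
theorem image_sigmaPlus (s : ℝ) {N : ℕ} (hsN : 2 * s = N) :
    (N : ℂ) + 1 = 2 - heunSigmaPlus (-s) := by
  have h' : (2 : ℂ) * (s : ℂ) = (N : ℂ) := by exact_mod_cast hsN
  unfold heunSigmaPlus; push_cast; linear_combination -h'

/-- Image exponent at `∞` (Umetsu's `β̃ = β + N`): `(2 − σ₋(s)) + 2s = 2 − σ₋(−s)`. -/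
theorem image_sigmaMinus (M a Λ s : ℝ) (ω : ℂ) (m : ℝ) {N : ℕ} (hsN : 2 * s = N) :
    2 - heunSigmaMinus M a Λ s ω m + N = 2 - heunSigmaMinus M a Λ (-s) ω m := by
  have h' : (2 : ℂ) * (s : ℂ) = (N : ℂ) := by exact_mod_cast hsN
  unfold heunSigmaMinus; push_cast; linear_combination -h'

/-- `δ_s − δ_{−s} = 2s`: the exponents at `z = 1` of the two Hatsuda frames differ by `N`. -/
theorem delta_sub_delta (M a Λ s : ℝ) (ω : ℂ) (m : ℝ) {N : ℕ} (hsN : 2 * s = N) :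
    heunDelta M a Λ s ω m - heunDelta M a Λ (-s) ω m = N := by
  have h' : (2 : ℂ) * (s : ℂ) = (N : ℂ) := by exact_mod_cast hsN
  unfold heunDelta; push_cast; linear_combination h'

/-- `δ_s − 1 = s + 2B(r_c)` (the branch exponent of the flipped frame at `z = 1`). -/
theorem delta_sub_one (M a Λ s : ℝ) (ω : ℂ) (m : ℝ) :
    heunDelta M a Λ s ω m - 1 = (s : ℂ) + 2 * horizonB M a Λ ω m (rCosmo M a Λ) := by
  unfold heunDelta; ring

/-- **The general-Heun part of the accessory bookkeeping** (pure algebra; CAS: pub-kds kit j175983):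
with `γ_{±} = 2B₁ ± s + 1`, `δ_{±} = 2B₂ ± s + 1`, `ε_{±} = 2B₃ ± s + 1` and `N = 2s`,
`shiftedQ(a_H; 2−γ₊, 2−δ₊, 2−ε₊; flipQ(γ₊,δ₊,ε₊; q); N) − flipQ(γ₋,δ₋,ε₋; q)`
`= 2s·(2(a_H+1)B₁ + 2a_H B₂ + 2B₃ + a_H + 1)`. -/
theorem shiftedQ_flipQ_sub (aH B₁ B₂ B₃ q : ℂ) (s : ℝ) {N : ℕ} (hsN : 2 * s = N) :
    shiftedQ aH (2 - (2 * B₁ + s + 1)) (2 - (2 * B₂ + s + 1)) (2 - (2 * B₃ + s + 1))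
        (flipQ aH (2 * B₁ + s + 1) (2 * B₂ + s + 1) (2 * B₃ + s + 1) q) N -
      flipQ aH (2 * B₁ + ((-s : ℝ) : ℂ) + 1) (2 * B₂ + ((-s : ℝ) : ℂ) + 1)
        (2 * B₃ + ((-s : ℝ) : ℂ) + 1) q =
      2 * (s : ℂ) * (2 * (aH + 1) * B₁ + 2 * aH * B₂ + 2 * B₃ + aH + 1) := by
  have h' : (N : ℂ) = 2 * (s : ℂ) := by exact_mod_cast hsN.symm
  unfold shiftedQ flipQ
  rw [h']
  push_cast
  ring

set_option maxRecDepth 8192 in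
/-- **The Kerr–de Sitter part of the accessory bookkeeping**: Hatsuda's accessory quantity at
`(−s, λ − 2s(1−α))` minus the one at `(s, λ)` is `2s·(2(z_r+1)B₁ + 2z_r B₂ + 2B₃ + z_r + 1)`
(uses Vieta's `1 − Λa²/3 = (Λ/3)(S² − e₂)` for the roots; CAS: pub-kds kit j175983). -/
theorem heunV_flip_diff {M a Λ : ℝ} (hsub : IsSubextremal M a Λ) (s : ℝ) (ω : ℂ) (m : ℝ) (lam : ℂ) :
    heunV M a Λ (-s) ω m (RouteW.lamFlip a Λ s lam) - heunV M a Λ s ω m lam =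
      2 * (s : ℂ) * (2 * ((mobiusZr M a Λ : ℂ) + 1) * horizonB M a Λ ω m (rPlus M a Λ) +
        2 * (mobiusZr M a Λ : ℂ) * horizonB M a Λ ω m (rCosmo M a Λ) +
        2 * horizonB M a Λ ω m (rNeg M a Λ) + (mobiusZr M a Λ : ℂ) + 1) := by
  have hV := vieta_sq hsub
  have hdy := deltaDeriv_at_rPlus hsub
  have hdz := deltaDeriv_at_rCosmo hsub
  have hdw := deltaDeriv_at_rNeg hsub
  have h0 := rMinus_nonneg M a Λ
  obtain ⟨hM, hΛ, h01, h12, -⟩ := hsub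
  -- `1 − α` through the roots
  have hα : (1 - alpha a Λ : ℝ) = Λ / 3 * ((rMinus M a Λ + rPlus M a Λ + rCosmo M a Λ) ^ 2 -
      (rMinus M a Λ * rPlus M a Λ + rPlus M a Λ * rCosmo M a Λ + rCosmo M a Λ * rMinus M a Λ)) := by
    unfold alpha; linarith
  have hw : rNeg M a Λ = -(rMinus M a Λ + rPlus M a Λ + rCosmo M a Λ) := rfl
  -- non-vanishing denominators
  have hxy : (rMinus M a Λ : ℂ) - rPlus M a Λ ≠ 0 := by
    exact_mod_cast (show rMinus M a Λ - rPlus M a Λ ≠ 0 by linarith)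
  have hyz : (rPlus M a Λ : ℂ) - rCosmo M a Λ ≠ 0 := by
    exact_mod_cast (show rPlus M a Λ - rCosmo M a Λ ≠ 0 by linarith)
  have hxz : (rMinus M a Λ : ℂ) - rCosmo M a Λ ≠ 0 := by
    exact_mod_cast (show rMinus M a Λ - rCosmo M a Λ ≠ 0 by linarith)
  have hxw : (rMinus M a Λ : ℂ) - (-(rMinus M a Λ + rPlus M a Λ + rCosmo M a Λ)) ≠ 0 := by
    exact_mod_cast (show rMinus M a Λ - (-(rMinus M a Λ + rPlus M a Λ + rCosmo M a Λ)) ≠ 0 by linarith)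
  have hyw : (rPlus M a Λ : ℂ) - (-(rMinus M a Λ + rPlus M a Λ + rCosmo M a Λ)) ≠ 0 := by
    exact_mod_cast (show rPlus M a Λ - (-(rMinus M a Λ + rPlus M a Λ + rCosmo M a Λ)) ≠ 0 by linarith)
  have hzw : (rCosmo M a Λ : ℂ) - (-(rMinus M a Λ + rPlus M a Λ + rCosmo M a Λ)) ≠ 0 := by
    exact_mod_cast (show rCosmo M a Λ - (-(rMinus M a Λ + rPlus M a Λ + rCosmo M a Λ)) ≠ 0 by linarith)
  have hwx : (-(rMinus M a Λ + rPlus M a Λ + rCosmo M a Λ) : ℂ) - rMinus M a Λ ≠ 0 := by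
    exact_mod_cast (show -(rMinus M a Λ + rPlus M a Λ + rCosmo M a Λ) - rMinus M a Λ ≠ 0 by linarith)
  have hwy : (-(rMinus M a Λ + rPlus M a Λ + rCosmo M a Λ) : ℂ) - rPlus M a Λ ≠ 0 := by
    exact_mod_cast (show -(rMinus M a Λ + rPlus M a Λ + rCosmo M a Λ) - rPlus M a Λ ≠ 0 by linarith)
  have hwz : (-(rMinus M a Λ + rPlus M a Λ + rCosmo M a Λ) : ℂ) - rCosmo M a Λ ≠ 0 := by
    exact_mod_cast (show -(rMinus M a Λ + rPlus M a Λ + rCosmo M a Λ) - rCosmo M a Λ ≠ 0 by linarith)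
  have hzy : (rCosmo M a Λ : ℂ) - rPlus M a Λ ≠ 0 := by
    exact_mod_cast (show rCosmo M a Λ - rPlus M a Λ ≠ 0 by linarith)
  have hyx : (rPlus M a Λ : ℂ) - rMinus M a Λ ≠ 0 := by
    exact_mod_cast (show rPlus M a Λ - rMinus M a Λ ≠ 0 by linarith)
  have hzx : (rCosmo M a Λ : ℂ) - rMinus M a Λ ≠ 0 := by
    exact_mod_cast (show rCosmo M a Λ - rMinus M a Λ ≠ 0 by linarith)
  have hΛ' : (Λ : ℂ) ≠ 0 := by exact_mod_cast hΛ.ne'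
  have h3 : (3 : ℂ) ≠ 0 := by norm_num
  unfold heunV RouteW.lamFlip mobiusZr mobiusZ horizonB radialK xi
  rw [hα, hdy, hdz, hdw, hw]
  push_cast
  field_simp
  ring

/-- **Accessory identity of the Teukolsky–Starobinsky transfer** (Umetsu's shifted accessory
parameter of the flipped spin-`s` data IS the flipped spin-`−s` data at `λ' = λ − 2s(1−α)`). -/
theorem accessory_identity {M a Λ : ℝ} (hsub : IsSubextremal M a Λ) (s : ℝ) (ω : ℂ) (m : ℝ)
    (lam : ℂ) {N : ℕ} (hsN : 2 * s = N) :
    shiftedQ (mobiusZr M a Λ : ℂ) (2 - heunGamma M a Λ s ω m) (2 - heunDelta M a Λ s ω m)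
        (2 - heunEps M a Λ s ω m)
        (flipQ (mobiusZr M a Λ : ℂ) (heunGamma M a Λ s ω m) (heunDelta M a Λ s ω m)
          (heunEps M a Λ s ω m) (heunV M a Λ s ω m lam)) N =
      flipQ (mobiusZr M a Λ : ℂ) (heunGamma M a Λ (-s) ω m) (heunDelta M a Λ (-s) ω m)
        (heunEps M a Λ (-s) ω m) (heunV M a Λ (-s) ω m (RouteW.lamFlip a Λ s lam)) := by
  have hE := shiftedQ_flipQ_sub (mobiusZr M a Λ : ℂ) (horizonB M a Λ ω m (rPlus M a Λ))
    (horizonB M a Λ ω m (rCosmo M a Λ)) (horizonB M a Λ ω m (rNeg M a Λ)) (heunV M a Λ s ω m lam)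
    s hsN
  have hD := heunV_flip_diff hsub s ω m lam
  have e1 : flipQ (mobiusZr M a Λ : ℂ) (heunGamma M a Λ (-s) ω m) (heunDelta M a Λ (-s) ω m)
        (heunEps M a Λ (-s) ω m) (heunV M a Λ (-s) ω m (RouteW.lamFlip a Λ s lam)) =
      flipQ (mobiusZr M a Λ : ℂ) (heunGamma M a Λ (-s) ω m) (heunDelta M a Λ (-s) ω m)
        (heunEps M a Λ (-s) ω m) (heunV M a Λ s ω m lam) +
        (heunV M a Λ (-s) ω m (RouteW.lamFlip a Λ s lam) - heunV M a Λ s ω m lam) := by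
    unfold flipQ; ring
  rw [e1, hD]
  unfold heunGamma heunDelta heunEps
  linear_combination hE

end SpinFlipTS

end Summit.Ventures.KdS
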